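import Summits.ABC.IUTFork.Cor312PilotIdelesPr
import Summits.ABC.IUTFork.Cor312ProvKIdeles
import Summits.ABC.IUTFork.Cor312NotPointwiseDHVolBInputs
import Literature.IUT.LogVolume.TensorPacketSlotUnion
import HarnessLib

/-!
# [IUTchIII] Cor. 3.12 — the sharp assembled REAL setting read off pilot ideles is CANONICAL:
# `settingPrVolSharp` depends on the Θ- and q-ideles only through their absolute values

PROOF-ONLY record file (D-0012; 0 definitions, 0 `Prop` facts) of the abc-iut cell, seat abc-iut-C-cert-2 (branch C certificate
seat; rung LADDER-ABC:A2.C), written for the RQ7 second read of branch C's certificate v6 `Conditional.abc_of_SH_v6K`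
(`Conditional/AbcOfSGenuineKChosen.lean`, abc-iut-C-cert-1, p437297), whose hull-level hypothesis `hSH` and Θ-side reading `hΘ` are
demanded at abc-iut-c312-7's print-normalised sharp real setting `Real.settingPrVolSharp` built from REALISING pilot ideles obtained
by `Exists.choose`. THE ONE QUESTION a reader must ask of such a certificate: does the hypothesis depend on WHICH realising ideles the
choice function returns? ANSWER (this file): NO. `settingPrVolSharp X hlog … tq t _ _ = settingPrVolSharp X hlog … tq' t' _ _` as soon as
`‖t_{Θ,i,x}‖ = ‖t'_{Θ,i,x}‖` and `‖t_{q,x}‖ = ‖t'_{q,x}‖` at every prime, label and place (`settingPrVolSharp_eq_of_norm_eq`) — a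
LITERAL EQUALITY of settings, hence of everything read off them (`Licence`, `PilotKummerCompatHull` at any lattice structure /
region reading / q-datum, `thetaHull`, `negLogTheta`, `negLogQ`, `Statement`). Since realising ideles have PRESCRIBED absolute values
(`log ‖t_{q,x}‖ = −P_q(x)·log N(x)/[F_x:ℚ_p]`, `log ‖t_{Θ,i,x}‖ = −P_{Θ,i+1}(x)·…`), any two realising choices give THE SAME setting
(`settingPrVolSharp_eq_of_realising`): the honestly-scaled genuine sharp setting is an invariant of the pilot datum `X` (and the
context binders), exactly as in print, where the regions are the arithmetic line bundles `𝒪_𝕃(−P_Θ)`, `𝒪_𝕃(−P_q)` (Dupuy–Hilado §3.9: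
«`𝒪_𝕃(−D) := a·𝒪_𝕃` for any `a` with `div(a) = D`»; [IUTchI] Ex. 3.2 (iv): `q̲_v` is ANY `2l`-th root of `q_v`).

MECHANISM. The Θ-box of the sharp reading is `ι_j(t)·(R_I)^∼` (abc-iut-c312-3 `sharpBoxDH`); a slot UNIT does not move `(R_I)^∼`
(abc-iut-S1 `iota_smul_normalizedPacket_eq_of_norm_eq_one`, [IUTchIV] Thm. 1.10 Step (v)), so the box depends on `t` only through
`‖t‖` (`sharpBoxDH_eq_of_norm_eq`). The q-region is the preimage of the polydisc `hullSet λ_q` of the q-centre, which reads only the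
norms `‖λ_{q,(v⃗,i)}‖ = ‖t_{q,v_j}‖` (`norm_qCentreDH_inr`; `hullSet_qCentreDH_eq_of_norm_eq`). abc-iut-c312-7's assembly
`Setting.ofComparison` consumes the q-centre ONLY through that hull-set and the Θ-boxes only through their preimages; all other
fields (column, lattice, Prop. 3.7 output, q-pilot data, frames) do not read the ideles. (The analogous statement for the datum-level
numbers `−|log(Θ)|`, `−|log(q)|` of `GenuineLogTheta` is abc-iut-w5-d156's `Literature.IUT.LogVolume.GenuineLogThetaIdeleInvariance`.)

HONEST FRAMING: bookkeeping about OUR typed objects; nothing here bears on `−|log(Θ)|` versus `−|log(q)|`, on [IUTchIII] Cor. 3.12 or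
on abc, and no side is taken on any author; typed ≠ proved; instantiated ≠ endorsed. [cite: DupuyHilado2025, §3.4, §3.7, §3.9]
[cite: Mochizuki2012, IUTchI Ex. 3.2 (iv) p. 71; IUTchIV Thm. 1.10 Step (v) p. 27] [claim: Mochizuki2012, status: disputed]
-/

noncomputable section

open Set Function NumberField IsDedekindDomain
open scoped Pointwise

namespace Summit.ABC.IUTFork.Thm311.Real

open Cor312 Cor312Vol Literature.IUT.LogThetaLattice Literature.IUT.LogVolume

variable {F : Type} [Field F] [NumberField F] (X : PilotData F) {logv : PadicLogs F} (hlog : LogvAnalytic logv)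
  (t t' : ∀ (pp : Nat.Primes) (_ : Fin X.lstar) (x : (thetaIndex X).Fibre (.inr pp)),
    haveI : Fact (pp : ℕ).Prime := ⟨pp.2⟩; kOf X pp.1 x)
  (tq tq' : ∀ (pp : Nat.Primes) (x : (thetaIndex X).Fibre (.inr pp)),
    haveI : Fact (pp : ℕ).Prime := ⟨pp.2⟩; kOf X pp.1 x)

/-! ## §1. The Θ-boxes and the q-hull-sets read only the absolute values of the ideles -/

/-- The label idele has the same absolute value for two Θ-idele families with the same absolute values. [cite: DupuyHilado2025, §3.9] -/
theorem norm_labelIdele_eq_of_norm_eq (h : ∀ pp i x, ‖t pp i x‖ = ‖t' pp i x‖) (pp : Nat.Primes) (j : (thetaIndex X).Label)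
    (x : (thetaIndex X).Fibre (.inr pp)) : ‖labelIdele X t pp j x‖ = ‖labelIdele X t' pp j x‖ := by
  unfold labelIdele
  split_ifs
  · exact h _ _ _
  · rfl

/-- **The sharp Θ-boxes `ι_j(t_{Θ,j,v_j})·(R_I)^∼` depend on the Θ-ideles only through their absolute values** (a slot unit does
not move `(R_I)^∼`). [cite: DupuyHilado2025, §3.7, §3.9] [cite: Mochizuki2012, IUTchIV Thm. 1.10 Step (v) p. 27] -/
theorem sharpBoxDH_eq_of_norm_eq (ht0 : ∀ pp i x, t pp i x ≠ 0) (h : ∀ pp i x, ‖t pp i x‖ = ‖t' pp i x‖) :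
    sharpBoxDH X hlog t = sharpBoxDH X hlog t' := by
  funext pp j e
  haveI : Fact (pp : ℕ).Prime := ⟨pp.2⟩
  have ha : labelIdele X t pp j (e (Fin.last _)) ≠ 0 := labelIdele_ne_zero X t ht0 pp j _
  have hn := norm_labelIdele_eq_of_norm_eq X t t' h pp j (e (Fin.last _))
  have hna : ‖labelIdele X t pp j (e (Fin.last _))‖ ≠ 0 := norm_ne_zero_iff.mpr ha
  have hu : ‖(labelIdele X t pp j (e (Fin.last _)))⁻¹ * labelIdele X t' pp j (e (Fin.last _))‖ = 1 := by
    rw [norm_mul, norm_inv, ← hn, inv_mul_cancel₀ hna]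
  have hdec : labelIdele X t' pp j (e (Fin.last _)) =
      labelIdele X t pp j (e (Fin.last _)) * ((labelIdele X t pp j (e (Fin.last _)))⁻¹ * labelIdele X t' pp j (e (Fin.last _))) := by
    rw [mul_inv_cancel_left₀ ha]
  -- `ι(t') = ι(t)·ι(u)` with `u = t⁻¹·t'` a unit, and `ι(u)·(R_I)^∼ = (R_I)^∼`
  have hmul : iota (pp : ℕ) ((presAt X hlog pp).kk e) (Fin.last _) (labelIdele X t' pp j (e (Fin.last _))) =
      iota (pp : ℕ) ((presAt X hlog pp).kk e) (Fin.last _) (labelIdele X t pp j (e (Fin.last _))) *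
        iota (pp : ℕ) ((presAt X hlog pp).kk e) (Fin.last _)
          ((labelIdele X t pp j (e (Fin.last _)))⁻¹ * labelIdele X t' pp j (e (Fin.last _))) := by
    conv_lhs => rw [hdec]
    exact map_mul _ _ _
  have key : iota (pp : ℕ) ((presAt X hlog pp).kk e) (Fin.last _) (labelIdele X t' pp j (e (Fin.last _))) •
        (normalizedPacket (pp : ℕ) ((presAt X hlog pp).kk e) : Set (PacketAlgebra (pp : ℕ) ((presAt X hlog pp).kk e))) =
      iota (pp : ℕ) ((presAt X hlog pp).kk e) (Fin.last _) (labelIdele X t pp j (e (Fin.last _))) •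
        (normalizedPacket (pp : ℕ) ((presAt X hlog pp).kk e) : Set (PacketAlgebra (pp : ℕ) ((presAt X hlog pp).kk e))) := by
    rw [hmul, ← smul_smul, iota_smul_normalizedPacket_eq_of_norm_eq_one (pp : ℕ) ((presAt X hlog pp).kk e) (Fin.last _) hu]
  exact key.symm

/-- **The q-hull-sets `λ_q·𝒪_L` depend on the q-ideles only through their absolute values** (`hullSet` is the polydisc of radii
`‖λ_{q,(v⃗,i)}‖ = ‖t_{q,v_j}‖`). [cite: DupuyHilado2025, §3.9] [cite: Mochizuki2012, IUTchIV Prop. 1.4 (i) p. 13] -/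
theorem hullSet_qCentreDH_eq_of_norm_eq (h : ∀ pp x, ‖tq pp x‖ = ‖tq' pp x‖) :
    ∀ (j : (thetaIndex X).Label) (vQ : (thetaIndex X).VQ),
      hullSet (factorFieldDH X hlog j vQ) (qCentreDH X hlog tq j vQ) = hullSet (factorFieldDH X hlog j vQ) (qCentreDH X hlog tq' j vQ)
  | _, .inl _ => by
    unfold hullSet
    exact congrArg (polydisc _) (funext fun s => s.elim)
  | j, .inr pp => by
    haveI : Fact (pp : ℕ).Prime := ⟨pp.2⟩
    unfold hullSet
    refine congrArg (polydisc _) (funext fun s => ?_)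
    obtain ⟨e, i⟩ := s
    exact (norm_qCentreDH_inr X hlog tq pp j e i).trans ((h pp _).trans (norm_qCentreDH_inr X hlog tq' pp j e i).symm)

/-! ## §2. The assembled sharp setting is a function of the absolute values of the ideles -/

section Setting

variable (M : Type) [Field M] [NumberField M]
  (archPk : ∀ (j : (thetaIndex X).Label) (vQ : (thetaIndex X).VQ), Set ((logShellsDH X logv).Packet j vQ))
  (archSub : ∀ (j : (thetaIndex X).Label) (v : (thetaIndex X).V),
    Set ((logShellsDH X logv).Packet j ((thetaIndex X).over v)))
  (Ψ : ℤ → ∀ v : (thetaIndex X).V, v ∈ (thetaIndex X).Vbad → Set ((logShellsDH X logv).StarPacket v))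
  (act : ℤ → ∀ v : (thetaIndex X).V, v ∈ (thetaIndex X).Vbad →
    (logShellsDH X logv).StarPacket v → Module.End ℚ ((logShellsDH X logv).StarPacket v))
  (Mmod : ℤ → ∀ j : (thetaIndex X).LabelStar, Set ((logShellsDH X logv).GlobalPacket j.1))
  (region : ℤ → ∀ j : (thetaIndex X).LabelStar, FinDivisor M → ∀ vQ : (thetaIndex X).VQ,
    Set ((logShellsDH X logv).Packet j.1 vQ))
  (n : ℤ) {HT : Type} {LogLink : HT → HT → Type} {IsFull : ∀ {s t : HT}, LogLink s t → Prop}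
  (lat : LGPGaussianLogThetaLattice LogLink IsFull)
  {Frd : Type} {IsoF : Frd → Frd → Type} {Ob : Frd → Type} {realify : Frd → Frd} {Strip : Type}
  {IsoS : Strip → Strip → Type} {Mv : ∀ v : (thetaIndex X).V, v ∈ (thetaIndex X).Vbad → Type}
  [∀ v h, Monoid (Mv v h)]
  (sig : GlobalLGPFrobenioidSignature (thetaIndex X).lstar (thetaIndex X).V (· ∈ (thetaIndex X).Vbad)
    Frd IsoF Ob realify Strip IsoS Mv)
  (split : SplittingMonoids Mv) {ObΔ : Type} {N : ∀ v : (thetaIndex X).V, v ∈ (thetaIndex X).Vbad → Type}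
  [∀ v h, Monoid (N v h)] (qData : QPilotData ObΔ N)

/-- **abc-iut-c312-1's assembled real setting reads the q-centre only through its hull-set**: two Θ-box binders that AGREE and two
q-centres with the SAME hull-sets give the SAME `settingPrVol` (a literal equality of `Cor312.Setting`s; the proof fields are
propositions). [cite: DupuyHilado2025, §3.9] -/
theorem settingPrVol_eq_of_hullSet_eq
    {thetaBox : ℤ → Ob sig.Clgp → ∀ (j : (thetaIndex X).Label) (vQ : (thetaIndex X).VQ),
      Set (∀ s : factorIdxDH X hlog j vQ, factorFieldDH X hlog j vQ s)}
    {qCentre qCentre' : ObΔ → ∀ (j : (thetaIndex X).Label) (vQ : (thetaIndex X).VQ),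
      ∀ s : factorIdxDH X hlog j vQ, factorFieldDH X hlog j vQ s}
    {hq : ∀ j vQ s, qCentre (qPilotObject qData) j vQ s ≠ 0} {hq' : ∀ j vQ s, qCentre' (qPilotObject qData) j vQ s ≠ 0}
    {hfin : ∀ j : (thetaIndex X).Label, (Function.support fun vQ =>
      ((situationPrVol X hlog M archPk archSub Ψ act Mmod region).D n).logvol j vQ
        (factorMapDH X hlog j vQ ⁻¹' hullSet (factorFieldDH X hlog j vQ) (qCentre (qPilotObject qData) j vQ))).Finite}
    {hfin' : ∀ j : (thetaIndex X).Label, (Function.support fun vQ =>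
      ((situationPrVol X hlog M archPk archSub Ψ act Mmod region).D n).logvol j vQ
        (factorMapDH X hlog j vQ ⁻¹' hullSet (factorFieldDH X hlog j vQ) (qCentre' (qPilotObject qData) j vQ))).Finite}
    (hqc : ∀ o j vQ, hullSet (factorFieldDH X hlog j vQ) (qCentre o j vQ) = hullSet (factorFieldDH X hlog j vQ) (qCentre' o j vQ)) :
    settingPrVol X hlog M archPk archSub Ψ act Mmod region n lat sig split qData thetaBox qCentre hq hfin =
      settingPrVol X hlog M archPk archSub Ψ act Mmod region n lat sig split qData thetaBox qCentre' hq' hfin' := by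
  have hfun : (fun (o : ObΔ) (j : (thetaIndex X).Label) (vQ : (thetaIndex X).VQ) =>
        factorMapDH X hlog j vQ ⁻¹' hullSet (factorFieldDH X hlog j vQ) (qCentre o j vQ)) =
      fun o j vQ => factorMapDH X hlog j vQ ⁻¹' hullSet (factorFieldDH X hlog j vQ) (qCentre' o j vQ) := by
    funext o j vQ
    rw [hqc]
  unfold settingPrVol Setting.ofComparison
  congr 1


/-- **THE SHARP SETTING IS A FUNCTION OF THE ABSOLUTE VALUES OF THE IDELES.** abc-iut-c312-7's print-normalised assembled real setting
`settingPrVolSharp` built from Θ-ideles `t` and q-ideles `tq` EQUALS the one built from `t'`, `tq'` as soon as `‖t_{Θ,i,x}‖ = ‖t'_{Θ,i,x}‖`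
and `‖t_{q,x}‖ = ‖t'_{q,x}‖` everywhere — a literal equality of `Cor312.Setting`s, so every quantity or clause read off the setting
(`Licence`, `PilotKummerCompatHull`, `thetaHull`, `negLogTheta`, `negLogQ`, `Statement`, …) agrees. [cite: DupuyHilado2025, §3.7, §3.9]
[cite: Mochizuki2012, IUTchIV Prop. 1.4 (i) p. 13, Thm. 1.10 Step (v) p. 27] -/
theorem settingPrVolSharp_eq_of_norm_eq (ht0 : ∀ pp i x, t pp i x ≠ 0)
    (htq0 : ∀ pp x, tq pp x ≠ 0)
    (htq1 : ∀ (pp : Nat.Primes) (x : (thetaIndex X).Fibre (.inr pp)),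
      haveI : Fact (pp : ℕ).Prime := ⟨pp.2⟩; placeOf X pp.1 x ∉ X.S → ‖tq pp x‖ = 1)
    (htq0' : ∀ pp x, tq' pp x ≠ 0)
    (htq1' : ∀ (pp : Nat.Primes) (x : (thetaIndex X).Fibre (.inr pp)),
      haveI : Fact (pp : ℕ).Prime := ⟨pp.2⟩; placeOf X pp.1 x ∉ X.S → ‖tq' pp x‖ = 1)
    (ht : ∀ pp i x, ‖t pp i x‖ = ‖t' pp i x‖) (htq : ∀ pp x, ‖tq pp x‖ = ‖tq' pp x‖) :
    settingPrVolSharp X hlog M archPk archSub Ψ act Mmod region n lat sig split qData tq t htq0 htq1 =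
      settingPrVolSharp X hlog M archPk archSub Ψ act Mmod region n lat sig split qData tq' t' htq0' htq1' := by
  unfold settingPrVolSharp
  rw [sharpBoxDH_eq_of_norm_eq X hlog t t' ht0 ht]
  exact settingPrVol_eq_of_hullSet_eq X hlog M archPk archSub Ψ act Mmod region n lat sig split qData
    (fun _ j vQ => hullSet_qCentreDH_eq_of_norm_eq X hlog tq tq' htq j vQ)

/-- Two non-zero elements of a normed field with the same `log ‖·‖` have the same absolute value. [folklore] -/
theorem norm_eq_of_log_norm_eq {K : Type} [NormedDivisionRing K] {a b : K} (ha : a ≠ 0) (hb : b ≠ 0)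
    (h : Real.log ‖a‖ = Real.log ‖b‖) : ‖a‖ = ‖b‖ :=
  Real.log_injOn_pos (Set.mem_Ioi.mpr (norm_pos_iff.mpr ha)) (Set.mem_Ioi.mpr (norm_pos_iff.mpr hb)) h

/-- **ANY TWO REALISING CHOICES OF PILOT IDELES GIVE THE SAME SHARP SETTING.** If `t`, `t'` both REALISE `P_Θ` and `tq`, `tq'` both REALISE
`P_q` in Dupuy–Hilado's normalisation (3.4) (abc-iut-c312-3 / c312-7's closed forms `log ‖t_{Θ,i,x}‖ = −P_{Θ,i+1}(x)·log N(x)/[F_x:ℚ_p]`,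
`log ‖t_{q,x}‖ = −P_q(x)·log N(x)/[F_x:ℚ_p]`), then the two print-normalised sharp settings COINCIDE: the honestly-scaled genuine setting is
an invariant of the pilot datum `X` and the context binders — as in print, where the regions are the line bundles `𝒪_𝕃(−P_Θ)`, `𝒪_𝕃(−P_q)`
(«`𝒪_𝕃(−D) := a·𝒪_𝕃` for ANY `a` with `div(a) = D`»). [cite: DupuyHilado2025, §3.4, §3.9] [cite: Mochizuki2012, IUTchI Ex. 3.2 (iv) p. 71] -/
theorem settingPrVolSharp_eq_of_realising (ht0 : ∀ pp i x, t pp i x ≠ 0) (ht0' : ∀ pp i x, t' pp i x ≠ 0)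
    (htq0 : ∀ pp x, tq pp x ≠ 0)
    (htq1 : ∀ (pp : Nat.Primes) (x : (thetaIndex X).Fibre (.inr pp)),
      haveI : Fact (pp : ℕ).Prime := ⟨pp.2⟩; placeOf X pp.1 x ∉ X.S → ‖tq pp x‖ = 1)
    (htq0' : ∀ pp x, tq' pp x ≠ 0)
    (htq1' : ∀ (pp : Nat.Primes) (x : (thetaIndex X).Fibre (.inr pp)),
      haveI : Fact (pp : ℕ).Prime := ⟨pp.2⟩; placeOf X pp.1 x ∉ X.S → ‖tq' pp x‖ = 1)
    (hT : ∀ (pp : Nat.Primes) (i : Fin X.lstar) (x : (thetaIndex X).Fibre (.inr pp)),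
      haveI : Fact (pp : ℕ).Prime := ⟨pp.2⟩
      Real.log ‖t pp i x‖ = -(X.thetaPilot i (placeOf X pp.1 x)) * logNorm F (placeOf X pp.1 x) / localDegree F (placeOf X pp.1 x))
    (hT' : ∀ (pp : Nat.Primes) (i : Fin X.lstar) (x : (thetaIndex X).Fibre (.inr pp)),
      haveI : Fact (pp : ℕ).Prime := ⟨pp.2⟩
      Real.log ‖t' pp i x‖ = -(X.thetaPilot i (placeOf X pp.1 x)) * logNorm F (placeOf X pp.1 x) / localDegree F (placeOf X pp.1 x))
    (hQ : ∀ (pp : Nat.Primes) (x : (thetaIndex X).Fibre (.inr pp)),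
      haveI : Fact (pp : ℕ).Prime := ⟨pp.2⟩
      Real.log ‖tq pp x‖ = -(X.qPilot (placeOf X pp.1 x)) * logNorm F (placeOf X pp.1 x) / localDegree F (placeOf X pp.1 x))
    (hQ' : ∀ (pp : Nat.Primes) (x : (thetaIndex X).Fibre (.inr pp)),
      haveI : Fact (pp : ℕ).Prime := ⟨pp.2⟩
      Real.log ‖tq' pp x‖ = -(X.qPilot (placeOf X pp.1 x)) * logNorm F (placeOf X pp.1 x) / localDegree F (placeOf X pp.1 x)) :
    settingPrVolSharp X hlog M archPk archSub Ψ act Mmod region n lat sig split qData tq t htq0 htq1 =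
      settingPrVolSharp X hlog M archPk archSub Ψ act Mmod region n lat sig split qData tq' t' htq0' htq1' :=
  settingPrVolSharp_eq_of_norm_eq X hlog t t' tq tq' M archPk archSub Ψ act Mmod region n lat sig split qData ht0 htq0 htq1 htq0' htq1'
    (fun pp i x => norm_eq_of_log_norm_eq (ht0 pp i x) (ht0' pp i x) ((hT pp i x).trans (hT' pp i x).symm))
    (fun pp x => norm_eq_of_log_norm_eq (htq0 pp x) (htq0' pp x) ((hQ pp x).trans (hQ' pp x).symm))

end Setting

/-! ## §3. At the `K`-level pilot datum of an initial Θ-datum: every realising choice gives the setting at the CHOSEN ideles of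
branch C's certificate v6 (`Conditional.abc_of_SH_v6K`, abc-iut-C-cert-1) — the `Exists.choose` there is immaterial -/

section OverK

open Cor312Prov Literature.IUT.HodgeTheaters

variable {F₀ K Fbar : Type} [Field F₀] [NumberField F₀] [Field K] [NumberField K] [Algebra F₀ K] [Field Fbar]
  [Algebra F₀ Fbar] [Algebra K Fbar] {E : WeierstrassCurve F₀} [E.IsElliptic] {l : ℕ} {Pb : BadPlacePredicates K}
  (D : InitialThetaData F₀ K Fbar E l Pb)
  (M : Type) [Field M] [NumberField M]
  (archPk : ∀ (j : (thetaIndex (pilotDataOfK D K)).Label) (vQ : (thetaIndex (pilotDataOfK D K)).VQ),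
    Set ((logShellsDH (pilotDataOfK D K) (analyticLogv K)).Packet j vQ))
  (archSub : ∀ (j : (thetaIndex (pilotDataOfK D K)).Label) (v : (thetaIndex (pilotDataOfK D K)).V),
    Set ((logShellsDH (pilotDataOfK D K) (analyticLogv K)).Packet j ((thetaIndex (pilotDataOfK D K)).over v)))
  (Ψ : ℤ → ∀ v : (thetaIndex (pilotDataOfK D K)).V, v ∈ (thetaIndex (pilotDataOfK D K)).Vbad →
    Set ((logShellsDH (pilotDataOfK D K) (analyticLogv K)).StarPacket v))
  (act : ℤ → ∀ v : (thetaIndex (pilotDataOfK D K)).V, v ∈ (thetaIndex (pilotDataOfK D K)).Vbad →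
    (logShellsDH (pilotDataOfK D K) (analyticLogv K)).StarPacket v →
      Module.End ℚ ((logShellsDH (pilotDataOfK D K) (analyticLogv K)).StarPacket v))
  (Mmod : ℤ → ∀ j : (thetaIndex (pilotDataOfK D K)).LabelStar, Set ((logShellsDH (pilotDataOfK D K) (analyticLogv K)).GlobalPacket j.1))
  (region : ℤ → ∀ j : (thetaIndex (pilotDataOfK D K)).LabelStar, FinDivisor M → ∀ vQ : (thetaIndex (pilotDataOfK D K)).VQ,
    Set ((logShellsDH (pilotDataOfK D K) (analyticLogv K)).Packet j.1 vQ))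
  (n : ℤ) {HT : Type} {LogLink : HT → HT → Type} {IsFull : ∀ {s t : HT}, LogLink s t → Prop}
  (lat : LGPGaussianLogThetaLattice LogLink IsFull)
  {Frd : Type} {IsoF : Frd → Frd → Type} {Ob : Frd → Type} {realify : Frd → Frd} {Strip : Type}
  {IsoS : Strip → Strip → Type}
  {Mv : ∀ v : (thetaIndex (pilotDataOfK D K)).V, v ∈ (thetaIndex (pilotDataOfK D K)).Vbad → Type} [∀ v h, Monoid (Mv v h)]
  (sig : GlobalLGPFrobenioidSignature (thetaIndex (pilotDataOfK D K)).lstar (thetaIndex (pilotDataOfK D K)).V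
    (· ∈ (thetaIndex (pilotDataOfK D K)).Vbad) Frd IsoF Ob realify Strip IsoS Mv)
  (split : SplittingMonoids Mv) {ObΔ : Type}
  {N : ∀ v : (thetaIndex (pilotDataOfK D K)).V, v ∈ (thetaIndex (pilotDataOfK D K)).Vbad → Type} [∀ v h, Monoid (N v h)]
  (qData : QPilotData ObΔ N)
  (t : ∀ (pp : Nat.Primes) (_ : Fin (pilotDataOfK D K).lstar) (x : (thetaIndex (pilotDataOfK D K)).Fibre (.inr pp)),
    haveI : Fact (pp : ℕ).Prime := ⟨pp.2⟩; kOf (pilotDataOfK D K) pp.1 x)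
  (tq : ∀ (pp : Nat.Primes) (x : (thetaIndex (pilotDataOfK D K)).Fibre (.inr pp)),
    haveI : Fact (pp : ℕ).Prime := ⟨pp.2⟩; kOf (pilotDataOfK D K) pp.1 x)

/-- **At the `K`-level pilot datum `pilotDataOfK D K`, EVERY realising choice of Θ- and q-ideles gives the sharp setting AT THE CHOSEN
IDELES of branch C's certificate v6** (`Conditional.abc_of_SH_v6K`, abc-iut-C-cert-1 p437297: `Exists.choose` of abc-iut-C-cert-3's
`Cor312Prov.exists_realising_{q,theta}Ideles_pilotDataOfK`). Hence v6's hypotheses `hSH`, `hΘ` do not depend on the choice function: they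
are the hull-level clause and the Θ-side reading at THE honestly-scaled genuine setting of the datum.
[cite: DupuyHilado2025, §3.4, §3.9] [cite: Mochizuki2012, IUTchI Ex. 3.2 (iv) p. 71] -/
theorem settingPrVolSharp_pilotDataOfK_eq_chosen (ht0 : ∀ pp i x, t pp i x ≠ 0) (htq0 : ∀ pp x, tq pp x ≠ 0)
    (htq1 : ∀ (pp : Nat.Primes) (x : (thetaIndex (pilotDataOfK D K)).Fibre (.inr pp)),
      haveI : Fact (pp : ℕ).Prime := ⟨pp.2⟩; placeOf (pilotDataOfK D K) pp.1 x ∉ (pilotDataOfK D K).S → ‖tq pp x‖ = 1)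
    (hT : ∀ (pp : Nat.Primes) (i : Fin (pilotDataOfK D K).lstar) (x : (thetaIndex (pilotDataOfK D K)).Fibre (.inr pp)),
      haveI : Fact (pp : ℕ).Prime := ⟨pp.2⟩
      Real.log ‖t pp i x‖ = -((pilotDataOfK D K).thetaPilot i (placeOf (pilotDataOfK D K) pp.1 x)) *
        logNorm K (placeOf (pilotDataOfK D K) pp.1 x) / localDegree K (placeOf (pilotDataOfK D K) pp.1 x))
    (hQ : ∀ (pp : Nat.Primes) (x : (thetaIndex (pilotDataOfK D K)).Fibre (.inr pp)),
      haveI : Fact (pp : ℕ).Prime := ⟨pp.2⟩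
      Real.log ‖tq pp x‖ = -((pilotDataOfK D K).qPilot (placeOf (pilotDataOfK D K) pp.1 x)) *
        logNorm K (placeOf (pilotDataOfK D K) pp.1 x) / localDegree K (placeOf (pilotDataOfK D K) pp.1 x)) :
    settingPrVolSharp (pilotDataOfK D K) (logvAnalytic_analyticLogv (F := K)) M archPk archSub Ψ act Mmod region n lat sig split qData
        tq t htq0 htq1 =
      settingPrVolSharp (pilotDataOfK D K) (logvAnalytic_analyticLogv (F := K)) M archPk archSub Ψ act Mmod region n lat sig split qData
        (exists_realising_qIdeles_pilotDataOfK D).choose (exists_realising_thetaIdeles_pilotDataOfK D).choose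
        (exists_realising_qIdeles_pilotDataOfK D).choose_spec.1 (exists_realising_qIdeles_pilotDataOfK D).choose_spec.2.1 :=
  settingPrVolSharp_eq_of_realising (pilotDataOfK D K) (logvAnalytic_analyticLogv (F := K)) t
    (exists_realising_thetaIdeles_pilotDataOfK D).choose tq (exists_realising_qIdeles_pilotDataOfK D).choose M archPk archSub Ψ act
    Mmod region n lat sig split qData ht0 (exists_realising_thetaIdeles_pilotDataOfK D).choose_spec.1 htq0 htq1
    (exists_realising_qIdeles_pilotDataOfK D).choose_spec.1 (exists_realising_qIdeles_pilotDataOfK D).choose_spec.2.1 hT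
    (exists_realising_thetaIdeles_pilotDataOfK D).choose_spec.2.2 hQ (exists_realising_qIdeles_pilotDataOfK D).choose_spec.2.2

end OverK

end Summit.ABC.IUTFork.Thm311.Real

end
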